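import Literature.NumberTheory.Automorphic.CuspidalTransposeInv
import Literature.NumberTheory.Automorphic.JPSSGlobalFunctionalEquation
import Literature.NumberTheory.Automorphic.AutomorphicRepsGLAssociatedL2Holds
import Literature.NumberTheory.Automorphic.AutomorphicRepsGLSatakeDictionaryHolds
import Literature.NumberTheory.Automorphic.AutomorphicLFunctionHolds
import HarnessLib

/-!
# The transpose-inverse twist of a clean `A_G`-invariant cuspidal datum: `L²` realisation and the
# dual Satake family (Jacquet–Langlands 1970, proof of Thm. 11.1; Borel–Jacquet 1979, 4.6)

Topic `Literature/NumberTheory/Automorphic`; proof file (theorems only: no definition, no named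
fact, no instance).

A brick of the remaining analytic package `(IR)` for CLEAN `A_G`-invariant cuspidal data `π` of
`GL₂(𝔸_K)` (`GlobalHeckeTheoryGL2OfClean`, hence the named facts
`JacquetLanglands1970_standardLTheoryGL2`, `JacquetLanglands1970_twistedHeckeTheoryGL2`,
`frobSatakeCompatibleAt_of_isPiOfArtinRep_of_isUnramifiedAt`).  The dual Euler product there is the
one of the transpose-inverse twist `π^τ` (`CuspidalAutomorphicRepData.transposeInv`), and the
partial-`L` machinery of the tree (`IsSatakeFamilyOf`, `partialStandardL`,
`multipliable_partialStandardL_holds` — Jacquet–Shalika) lives on `L²` cuspidal representations.  So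
`π^τ` too must be realised in `L²_cusp`, with Satake family the dual family `α∨ v = (α v)⁻¹`
(`dualFamily`) of a Satake family `α` of the realisation of `π`:

* `AutomorphicRepData.transposeInv_W'_eq_bot` — `π^τ` is clean when `π` is (`W' ∘ τ = ⊥ ∘ τ = ⊥`);
* `AutomorphicRepData.transposeInv_posRealScalar_invariant` — `π^τ` is `A_G`-invariant when `π` is:
  `τ(z_t g) = z_{t⁻¹} τ(g)` for the central `z_t = posRealScalar t` (`glTransposeInv_posRealScalar`,
  `posRealScalar_mem_center`);
* `CuspidalAutomorphicRepData.exists_isAssociatedL2_transposeInv` — hence `π^τ` is associated with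
  some cuspidal `Π∨ ≤ L²_cusp(GL_n(𝔸_K) ⧸ A_G GL_n(K), μ)`
  (`AutomorphicRepsGL.exists_isAssociatedL2_holds`, Borel–Jacquet 1979, 4.4–4.6);
* `IsSatakeFamilyOf.dualFamily_of_isAssociatedL2_transposeInv` (**main**) — if `π` is associated
  with `Π`, `π^τ` with `Π∨`, and `α` is a Satake family of `Π` off `S`, then `α∨` is a Satake family
  of `Π∨` off `S` (`hasSatakeParamAt_iff_L2_holds` in both directions and
  `AutomorphicRepData.HasSatakeParamAt.transposeInv`: `t_{π^τ, v} = t_{π, v}⁻¹`);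
* `multipliable_partialEuler_dualFamily` — consequently the partial dual Euler product
  `∏_{v ∉ S} ∏_{a ∈ α v} (1 - a⁻¹ q_v^{-s})⁻¹` is multipliable for `re s > 1` (Jacquet–Shalika,
  `multipliable_partialStandardL_holds` for `Π∨`) — the hypothesis `hpart` of
  `tprod_localEulerPolynomial_transposeInv_eq_prod_mul_partialStandardL_dualFamily`
  (`CleanCuspidalGL2UnramifiedEulerFactors`).

Everything is stated for `GL_n`.  (Jacquet–Langlands 1970, p. 169: "Observe that if
`π = ⊗_v π_v` then `π̃ = ⊗_v π̃_v`"; p. 172: "We can also introduce `Ψ̃(g, s, φ₁)` … and show that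
`Ψ̃(g, s, φ₁) = L(s, π̃) Φ̃(g, s, φ₁)`".)

## References

* H. Jacquet, R. P. Langlands, *Automorphic Forms on GL(2)*, LNM 114 (1970), proof of Thm. 11.1.
  [JacquetLanglands1970]
* A. Borel, H. Jacquet, *Automorphic forms and automorphic representations*, Corvallis 1979,
  §4.4–4.6, 5.7. [BorelJacquetCorvallis1979]
* H. Jacquet, J. A. Shalika, *On Euler products and the classification of automorphic
  representations I*, Amer. J. Math. 103 (1981), Thm. (5.3). [JacquetShalikaAJM1981]
-/

noncomputable section

open scoped MatrixGroups Matrix NNReal Classical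
open MeasureTheory NumberField IsDedekindDomain Polynomial

namespace Literature.NumberTheory.Automorphic

variable {n : ℕ} {K : Type} [Field K] [NumberField K] {hcpt : isCompact_glFiniteIntegralLevel n K}

/-! ### `π^τ` is clean and `A_G`-invariant when `π` is -/

/-- **`π^τ` is clean when `π` is**: `(π^τ).W' = W' ∘ τ = ⊥`. [folklore] -/
theorem AutomorphicRepData.transposeInv_W'_eq_bot {π : AutomorphicRepData (AutomorphyDatum.gl n K hcpt)}
    (h : π.W' = ⊥) : π.transposeInv.W' = ⊥ := by
  rw [AutomorphicRepData.transposeInv_W', h, Submodule.map_bot]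

/-- Cuspidal version of `transposeInv_W'_eq_bot`. [folklore] -/
theorem CuspidalAutomorphicRepData.transposeInv_W'_eq_bot {π : CuspidalAutomorphicRepData n K hcpt}
    (h : π.1.W' = ⊥) : π.transposeInv.1.W' = ⊥ := by
  rw [CuspidalAutomorphicRepData.transposeInv_val]
  exact AutomorphicRepData.transposeInv_W'_eq_bot h

/-- `τ(z_t g) = z_{t⁻¹} τ(g)` for the central positive real scalar `z_t = posRealScalar t` and
`τ(g) = w₀ ᵗg⁻¹ w₀` (`glTransposeInv_posRealScalar`, `posRealScalar_mem_center`). [folklore] -/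
theorem weylLong_mul_glTransposeInv_posRealScalar_mul_mul_weylLong (t : ℝ≥0ˣ)
    (g : GL (Fin n) (AdeleRing (𝓞 K) K)) :
    weylLong n (AdeleRing (𝓞 K) K) *
        GaloisRepresentations.glTransposeInv (Fin n) (AdeleRing (𝓞 K) K) (posRealScalar n K t * g) *
        weylLong n (AdeleRing (𝓞 K) K) =
      posRealScalar n K t⁻¹ *
        (weylLong n (AdeleRing (𝓞 K) K) * GaloisRepresentations.glTransposeInv (Fin n) (AdeleRing (𝓞 K) K) g *
          weylLong n (AdeleRing (𝓞 K) K)) := by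
  rw [map_mul, glTransposeInv_posRealScalar, ← mul_assoc,
    Subgroup.mem_center_iff.1 (posRealScalar_mem_center n K t⁻¹) (weylLong n (AdeleRing (𝓞 K) K))]
  simp only [mul_assoc]

/-- **`π^τ` is `A_G`-invariant when `π` is**: for `φ = φ₀ ∘ τ` with `φ₀ ∈ W` and the central
`z_t = posRealScalar t`, `φ(z_t g) = φ₀(w₀ ᵗz_t⁻¹ ᵗg⁻¹ w₀) = φ₀(z_{t⁻¹} τ(g)) = φ₀(τ(g)) = φ(g)`
(`glTransposeInv_posRealScalar`, `posRealScalar_mem_center`). [folklore] -/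
theorem AutomorphicRepData.transposeInv_posRealScalar_invariant
    {π : AutomorphicRepData (AutomorphyDatum.gl n K hcpt)}
    (hAG : ∀ φ ∈ π.W, ∀ (t : ℝ≥0ˣ) (g : (AdelicGroupData.gl n K).Adelic),
      φ ((show (AdelicGroupData.gl n K).Adelic from posRealScalar n K t) * g) = φ g) :
    ∀ φ ∈ π.transposeInv.W, ∀ (t : ℝ≥0ˣ) (g : (AdelicGroupData.gl n K).Adelic),
      φ ((show (AdelicGroupData.gl n K).Adelic from posRealScalar n K t) * g) = φ g := by
  intro φ hφ t g
  rw [AutomorphicRepData.transposeInv_W] at hφ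
  obtain ⟨φ₀, hφ₀, rfl⟩ := Submodule.mem_map.1 hφ
  simp only [LinearMap.funLeft_apply]
  exact (congrArg φ₀ (weylLong_mul_glTransposeInv_posRealScalar_mul_mul_weylLong t g)).trans
    (hAG φ₀ hφ₀ t⁻¹ _)

/-- Cuspidal version of `transposeInv_posRealScalar_invariant`. [folklore] -/
theorem CuspidalAutomorphicRepData.transposeInv_posRealScalar_invariant
    {π : CuspidalAutomorphicRepData n K hcpt}
    (hAG : ∀ φ ∈ π.1.W, ∀ (t : ℝ≥0ˣ) (g : (AdelicGroupData.gl n K).Adelic),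
      φ ((show (AdelicGroupData.gl n K).Adelic from posRealScalar n K t) * g) = φ g) :
    ∀ φ ∈ π.transposeInv.1.W, ∀ (t : ℝ≥0ˣ) (g : (AdelicGroupData.gl n K).Adelic),
      φ ((show (AdelicGroupData.gl n K).Adelic from posRealScalar n K t) * g) = φ g := by
  rw [CuspidalAutomorphicRepData.transposeInv_val]
  exact AutomorphicRepData.transposeInv_posRealScalar_invariant hAG

/-! ### `L²` realisation of `π^τ` and the dual Satake family -/

variable {μ : Measure (AdelicGroupData.gl n K).automorphicQuotient}
  [(AdelicGroupData.gl n K).IsAutomorphicMeasure μ]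

variable (μ) in
/-- **`π^τ` is realised in `L²_cusp`** when `π` is `A_G`-invariant (Borel–Jacquet 1979, 4.4–4.6:
`AutomorphicRepsGL.exists_isAssociatedL2_holds` applied to the `A_G`-invariant datum `π^τ`).
[cite: BorelJacquetCorvallis1979, §4.6] -/
theorem CuspidalAutomorphicRepData.exists_isAssociatedL2_transposeInv
    (π : CuspidalAutomorphicRepData n K hcpt)
    (hAG : ∀ φ ∈ π.1.W, ∀ (t : ℝ≥0ˣ) (g : (AdelicGroupData.gl n K).Adelic),
      φ ((show (AdelicGroupData.gl n K).Adelic from posRealScalar n K t) * g) = φ g) :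
    ∃ Pd : CuspidalAutomorphicRepGL n K μ, IsAssociatedL2 π.transposeInv Pd := by
  refine AutomorphicRepsGL.exists_isAssociatedL2_holds hcpt μ π.transposeInv ?_
  intro φ hφ z hz g
  obtain ⟨t, rfl⟩ := MonoidHom.mem_range.1 hz
  exact CuspidalAutomorphicRepData.transposeInv_posRealScalar_invariant hAG φ hφ t g

/-- **The dual Satake family is a Satake family of the `L²` realisation of `π^τ`.** If `π` is
associated with `Π`, `π^τ` with `Π∨`, and `α` is a Satake family of `Π` off `S`, then
`α∨ v = (α v)⁻¹` is a Satake family of `Π∨` off `S`: the `L²` Satake parameter `α v` of `Π` is a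
Borel–Jacquet Satake parameter of `π` (`hasSatakeParamAt_iff_L2_holds`), hence `(α v)⁻¹` one of `π^τ`
(`AutomorphicRepData.HasSatakeParamAt.transposeInv`), hence an `L²` one of `Π∨`.
[cite: JacquetLanglands1970, Thm. 11.1 (proof, p. 169)] [cite: BorelJacquetCorvallis1979, §4.6] -/
theorem IsSatakeFamilyOf.dualFamily_of_isAssociatedL2_transposeInv
    {π : CuspidalAutomorphicRepData n K hcpt} {Pl Pd : CuspidalAutomorphicRepGL n K μ}
    (hass : IsAssociatedL2 π Pl) (hassd : IsAssociatedL2 π.transposeInv Pd)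
    {S : Set (HeightOneSpectrum (𝓞 K))} {α : SatakeFamily K} (hα : IsSatakeFamilyOf Pl S α) :
    IsSatakeFamilyOf Pd S (dualFamily α) := by
  intro v hv
  obtain ⟨𝔫, h𝔫, hvn, ϖ, hSat⟩ := hα v hv
  have hA : π.1.HasSatakeParamAt v (α v) :=
    (hasSatakeParamAt_iff_L2_holds hcpt μ hass v (α v)).2 ⟨𝔫, ϖ, h𝔫, hvn, hSat⟩
  have hA' : π.transposeInv.1.HasSatakeParamAt v ((α v).map (·⁻¹)) := by
    rw [CuspidalAutomorphicRepData.transposeInv_val]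
    exact hA.transposeInv
  obtain ⟨𝔫', ϖ', h𝔫', hvn', hSat'⟩ :=
    (hasSatakeParamAt_iff_L2_holds hcpt μ hassd v ((α v).map (·⁻¹))).1 hA'
  exact ⟨𝔫', h𝔫', hvn', ϖ', by rwa [dualFamily_apply]⟩

/-- **The partial dual Euler product is multipliable for `re s > 1`**: with `π`, `Π`, `Π∨`, `α` as
in `IsSatakeFamilyOf.dualFamily_of_isAssociatedL2_transposeInv`,
`∏_{v ∉ S} ∏_{a ∈ α v} (1 - a⁻¹ q_v^{-s})⁻¹` is multipliable (Jacquet–Shalika, Thm. (5.3), for `Π∨`: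
`multipliable_partialStandardL_holds`). [cite: JacquetShalikaAJM1981, Thm. (5.3)] -/
theorem multipliable_partialEuler_dualFamily
    {π : CuspidalAutomorphicRepData n K hcpt} {Pl Pd : CuspidalAutomorphicRepGL n K μ}
    (hass : IsAssociatedL2 π Pl) (hassd : IsAssociatedL2 π.transposeInv Pd)
    {S : Set (HeightOneSpectrum (𝓞 K))} {α : SatakeFamily K} (hα : IsSatakeFamilyOf Pl S α)
    {s : ℂ} (hs : 1 < s.re) :
    Multipliable fun v : {v : HeightOneSpectrum (𝓞 K) // v ∉ S} =>
      ((eulerPolynomial (dualFamily α v.1)).eval ((v.1.residueCard : ℂ) ^ (-s)))⁻¹ :=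
  multipliable_partialStandardL_holds Pd (hα.dualFamily_of_isAssociatedL2_transposeInv hass hassd) hs

end Literature.NumberTheory.Automorphic

end
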